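/-
Origin: expansion seat `planner-pub-hodgecm-pv09-g4-0`, handover #2 2026-08-18T07:11:37Z (`HOME/pub-hodgecm-pv09-g4/lean/Pv09g4/DiscreteFundamentalDomain.lean`, md5 1d1eac5d, 397 lines);
landed by the gen-7 packager in gate run 25 as `HodgeCM/PerL34/DiscreteFundamentalDomain.lean` (verbatim).
-/
/-
HodgeCM / PerL34 publication cell — seam S3 support (pub-hodgecm-pv09-g4, HANDOVER #2 (a)).
Mathlib-only.  Complete proofs, no new axioms, no cited facts.
-/
import Mathlib
import Literature.MeasureTheory.Group.DiscreteSubgroupDomain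

/-!
# Measurable fundamental domains for discrete subgroups

Mathlib (v4.32) has the *predicate* `MeasureTheory.IsFundamentalDomain`, the class
`MeasureTheory.HasFundamentalDomain` and the `ZLattice` instance, but no general existence
theorem.  This file proves the classical one (Bourbaki, *Intégration* VII §2, exerc.;
Raghunathan, *Discrete subgroups of Lie groups*, Ch. I):

* `exists_subset_measurableSet_existsUnique` — the abstract construction: a countable group `Γ`
  acting measurably on a second-countable space `X`, a measurable set `K` meeting every orbit,
  and around every point of `K` an open set `V` with `γ • V ∩ V = ∅` for `γ ≠ 1`; then there is a
  measurable `𝓕 ⊆ K` containing EXACTLY ONE point of every orbit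
  (`∀ x, ∃! γ : Γ, γ • x ∈ 𝓕`), hence `IsFundamentalDomain Γ 𝓕 μ` for EVERY measure `μ`
  (`MeasureTheory.IsFundamentalDomain.mk'`).
  Construction: a countable subcover `K ⊆ ⋃ₙ uₙ` by such open sets and
  `𝓕 := ⋃ₙ (uₙ ∩ K) \ Γ • (⋃_{m<n} (uₘ ∩ K))`.
* `Subgroup.exists_fundamentalDomain_left/_op` — for a DISCRETE subgroup `Γ` of a second
  countable topological group `G` (Borel σ-algebra), for the left action of `Γ` and for the right
  action (`Γ.op`); the local sets are translates of a symmetric open `W ∋ 1` with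
  `W W⁻¹ ∪ W⁻¹ W ⊆ U`, `U ∩ Γ = {1}`.
* cocompact refinement (`[LocallyCompactSpace G] [CompactSpace (G ⧸ Γ)]`):
  `𝓕` may be chosen relatively compact (`IsCompact (closure 𝓕)`), so `μ 𝓕 < ⊤` for every
  measure finite on compacts — for the right action in general and for the left action when `Γ`
  is normal (e.g. `G` commutative, the case of seam S3: `U(W_i)(L₀) ≤ U(W_i)(𝔸)`).

These make the DATA fields `𝓕 / isFundamentalDomain` of `HodgeCM.Automorphic.QuotientModel`
and the fields `countable / exists_fundamentalDomain` of
`HodgeCM.Automorphic.RegularRep.IsCocompactHaarModel` constructible from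
"`Γ` discrete, `G ⧸ Γ` compact, `G` second countable", and discharge the binders
`h𝓕 : IsFundamentalDomain jA.range 𝓕 μ`, `vol_ne_top : μ 𝓕 ≠ ⊤` of
`HodgeCM.PerL34.PureTensor.theta_ne_zero_rallis` (see `RallisHaarDomain.lean`).
-/

set_option autoImplicit false

noncomputable section

open MeasureTheory Set Filter Topology
open scoped Pointwise

namespace HodgeCM.PerL34.DiscreteFD

/-! ## §1 The combinatorial construction for a countable group action -/

section Construction

variable {Γ : Type*} {X : Type*} [Group Γ] [MulAction Γ X]

variable (Γ) in
/-- The `n`-th piece: `A n` minus the `Γ`-saturation of the earlier sets `A m`, `m < n`. -/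
def piece (A : ℕ → Set X) (n : ℕ) : Set X :=
  A n \ ⋃ (m : ℕ) (_ : m < n), ⋃ γ : Γ, γ • A m

variable (Γ) in
/-- The candidate fundamental domain: the union of the pieces. -/
def dom (A : ℕ → Set X) : Set X := ⋃ n, piece Γ A n

/-- (Ported verbatim from the HodgeCMPerL package; no docstring in the source.) -/
theorem piece_subset (A : ℕ → Set X) (n : ℕ) : piece Γ A n ⊆ A n := fun _ hx => hx.1

/-- (Ported verbatim from the HodgeCMPerL package; no docstring in the source.) -/
theorem dom_subset {A : ℕ → Set X} {K : Set X} (hAK : ∀ n, A n ⊆ K) : dom Γ A ⊆ K :=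
  iUnion_subset fun n => (piece_subset (Γ := Γ) A n).trans (hAK n)

/-- (Ported verbatim from the HodgeCMPerL package; no docstring in the source.) -/
theorem measurableSet_dom [MeasurableSpace X] [Countable Γ] [MeasurableConstSMul Γ X]
    {A : ℕ → Set X} (hA : ∀ n, MeasurableSet (A n)) : MeasurableSet (dom Γ A) :=
  MeasurableSet.iUnion fun n => (hA n).diff <| MeasurableSet.iUnion fun m =>
    MeasurableSet.iUnion fun _ => MeasurableSet.iUnion fun γ => (hA m).const_smul γ

/-- The separation property of the pieces: if `y` lies in a piece and `δ • y` lies in a piece,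
then `δ = 1` — provided each `A n` is moved off itself by every `γ ≠ 1`. -/
theorem eq_one_of_smul_mem_piece {A : ℕ → Set X}
    (hdisj : ∀ (n : ℕ) (γ : Γ), γ ≠ 1 → Disjoint (γ • A n) (A n))
    {n m : ℕ} {y : X} {δ : Γ} (hy : y ∈ piece Γ A n) (hδ : δ • y ∈ piece Γ A m) : δ = 1 := by
  rcases lt_trichotomy m n with hmn | rfl | hnm
  · exfalso
    refine hy.2 (mem_iUnion₂.2 ⟨m, hmn, mem_iUnion.2 ⟨δ⁻¹, ?_⟩⟩)
    refine mem_smul_set_iff_inv_smul_mem.2 ?_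
    rw [inv_inv]
    exact hδ.1
  · by_contra h
    exact Set.disjoint_left.1 (hdisj m δ h) (smul_mem_smul_set hy.1) hδ.1
  · exfalso
    exact hδ.2 (mem_iUnion₂.2 ⟨n, hnm, mem_iUnion.2 ⟨δ, smul_mem_smul_set hy.1⟩⟩)

/-- Every orbit meets `dom Γ A` in exactly one point. -/
theorem existsUnique_smul_mem_dom {A : ℕ → Set X}
    (hdisj : ∀ (n : ℕ) (γ : Γ), γ ≠ 1 → Disjoint (γ • A n) (A n))
    (hcov : ∀ x : X, ∃ (γ : Γ) (n : ℕ), γ • x ∈ A n) (x : X) :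
    ∃! γ : Γ, γ • x ∈ dom Γ A := by
  classical
  have hex : ∃ n, ∃ γ : Γ, γ • x ∈ A n := by
    obtain ⟨γ, n, h⟩ := hcov x
    exact ⟨n, γ, h⟩
  obtain ⟨γ, hγ⟩ := Nat.find_spec hex
  have hpiece : γ • x ∈ piece Γ A (Nat.find hex) := by
    refine ⟨hγ, fun hmem => ?_⟩
    obtain ⟨m, hm, hm'⟩ := mem_iUnion₂.1 hmem
    obtain ⟨δ, hδ⟩ := mem_iUnion.1 hm'
    refine Nat.find_min hex hm ⟨δ⁻¹ * γ, ?_⟩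
    rw [mul_smul]
    exact mem_smul_set_iff_inv_smul_mem.1 hδ
  refine ⟨γ, mem_iUnion.2 ⟨_, hpiece⟩, fun γ' hγ' => ?_⟩
  obtain ⟨m, hm⟩ := mem_iUnion.1 hγ'
  have h1 : γ' * γ⁻¹ = 1 := by
    refine eq_one_of_smul_mem_piece hdisj hpiece (m := m) ?_
    rwa [mul_smul, inv_smul_smul]
  exact mul_inv_eq_one.1 h1

/-- The exact-one-representative property gives `IsFundamentalDomain` for EVERY measure. -/
theorem isFundamentalDomain_of_existsUnique [MeasurableSpace X] {𝓕 : Set X}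
    (h𝓕 : MeasurableSet 𝓕) (h : ∀ x : X, ∃! γ : Γ, γ • x ∈ 𝓕) (μ : Measure X) :
    IsFundamentalDomain Γ 𝓕 μ :=
  IsFundamentalDomain.mk' h𝓕.nullMeasurableSet h

end Construction

/-! ## §2 From local separation data to a fundamental domain -/

section Local

variable {Γ : Type*} {X : Type*} [Group Γ] [MulAction Γ X] [TopologicalSpace X]

/-- A countable family of open sets, each moved off itself by every `γ ≠ 1`, covering `K`. -/
theorem exists_seq [SecondCountableTopology X] {K : Set X}
    (hV : ∀ x ∈ K, ∃ V : Set X, IsOpen V ∧ x ∈ V ∧ ∀ γ : Γ, γ ≠ 1 → Disjoint (γ • V) V) :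
    ∃ u : ℕ → Set X, (∀ n, IsOpen (u n)) ∧
      (∀ (n : ℕ) (γ : Γ), γ ≠ 1 → Disjoint (γ • u n) (u n)) ∧ K ⊆ ⋃ n, u n := by
  rcases K.eq_empty_or_nonempty with rfl | hK
  · exact ⟨fun _ => ∅, fun _ => isOpen_empty, fun n γ _ => by simp, empty_subset _⟩
  have hV' : ∀ x : K, ∃ V : Set X, IsOpen V ∧ (x : X) ∈ V ∧
      ∀ γ : Γ, γ ≠ 1 → Disjoint (γ • V) V := fun x => hV x x.2
  choose V hVo hxV hVd using hV'
  obtain ⟨T, hTc, hTU⟩ := TopologicalSpace.isOpen_iUnion_countable V hVo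
  haveI : Nonempty K := hK.to_subtype
  obtain ⟨f, hf⟩ := Set.countable_iff_exists_subset_range.1 hTc
  refine ⟨fun n => V (f n), fun n => hVo _, fun n γ hγ => hVd _ γ hγ, fun x hx => ?_⟩
  have hxU : x ∈ ⋃ i ∈ T, V i := by
    rw [hTU]
    exact mem_iUnion.2 ⟨⟨x, hx⟩, hxV _⟩
  obtain ⟨i, hi, hxi⟩ := mem_iUnion₂.1 hxU
  obtain ⟨n, rfl⟩ := hf hi
  exact mem_iUnion.2 ⟨n, hxi⟩

/-- **Abstract existence theorem.**  A countable group acting measurably on a second countable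
space, a measurable `K` meeting every orbit, and local separation at the points of `K` give a
measurable `𝓕 ⊆ K` meeting every orbit in exactly one point. -/
theorem exists_subset_measurableSet_existsUnique [SecondCountableTopology X]
    [MeasurableSpace X] [OpensMeasurableSpace X] [Countable Γ] [MeasurableConstSMul Γ X]
    {K : Set X} (hKm : MeasurableSet K) (hKcov : ∀ x : X, ∃ γ : Γ, γ • x ∈ K)
    (hV : ∀ x ∈ K, ∃ V : Set X, IsOpen V ∧ x ∈ V ∧ ∀ γ : Γ, γ ≠ 1 → Disjoint (γ • V) V) :
    ∃ 𝓕 : Set X, 𝓕 ⊆ K ∧ MeasurableSet 𝓕 ∧ ∀ x : X, ∃! γ : Γ, γ • x ∈ 𝓕 := by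
  obtain ⟨u, huo, hud, hKu⟩ := exists_seq (Γ := Γ) hV
  refine ⟨dom Γ (fun n => u n ∩ K), dom_subset fun n => inter_subset_right,
    measurableSet_dom fun n => (huo n).measurableSet.inter hKm,
    existsUnique_smul_mem_dom (fun n γ hγ => ?_) (fun x => ?_)⟩
  · exact (hud n γ hγ).mono (smul_set_mono inter_subset_left) inter_subset_left
  · obtain ⟨γ, hγ⟩ := hKcov x
    obtain ⟨n, hn⟩ := mem_iUnion.1 (hKu hγ)
    exact ⟨γ, n, hn, hγ⟩

end Local

/-! ## §3 Discrete subgroups of topological groups -/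

section Group

variable {G : Type*} [Group G] [TopologicalSpace G]

/-- A discrete subgroup of a second countable space is countable. -/
theorem countable_of_discrete [SecondCountableTopology G] (Γ : Subgroup G) [DiscreteTopology Γ] :
    Countable Γ :=
  TopologicalSpace.separableSpace_iff_countable.1 inferInstance

/-- (Ported verbatim from the HodgeCMPerL package; no docstring in the source.) -/
instance countable_op [SecondCountableTopology G] (Γ : Subgroup G) [DiscreteTopology Γ] :
    Countable Γ.op :=
  haveI := countable_of_discrete Γ
  Countable.of_equiv _ Γ.equivOp

/-- A discrete subgroup meets some neighbourhood of `1` only in `1`. -/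
theorem exists_nhds_one_eq_one (Γ : Subgroup G) [DiscreteTopology Γ] :
    ∃ U ∈ 𝓝 (1 : G), ∀ γ : Γ, (γ : G) ∈ U → γ = 1 := by
  obtain ⟨U, hUo, hU⟩ := isOpen_induced_iff.1 (isOpen_discrete ({1} : Set Γ))
  refine ⟨U, hUo.mem_nhds ?_, fun γ hγ => ?_⟩
  · have h : (1 : Γ) ∈ ((↑) : Γ → G) ⁻¹' U := by
      rw [hU]
      exact rfl
    exact h
  · have h : γ ∈ ((↑) : Γ → G) ⁻¹' U := hγ
    rw [hU] at h
    exact h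

variable [IsTopologicalGroup G]

/-- A symmetric open neighbourhood `W` of `1` with `W W⁻¹ ⊆ U` and `W⁻¹ W ⊆ U`. -/
theorem exists_open_symm_nhds {U : Set G} (hU : U ∈ 𝓝 (1 : G)) :
    ∃ W : Set G, IsOpen W ∧ (1 : G) ∈ W ∧ (∀ a ∈ W, ∀ b ∈ W, a * b⁻¹ ∈ U) ∧
      ∀ a ∈ W, ∀ b ∈ W, a⁻¹ * b ∈ U := by
  obtain ⟨V, hV, hVU⟩ := exists_nhds_split_inv hU
  refine ⟨interior V ∩ (interior V)⁻¹, isOpen_interior.inter isOpen_interior.inv,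
    ⟨mem_interior_iff_mem_nhds.2 hV, ?_⟩, fun a ha b hb => ?_, fun a ha b hb => ?_⟩
  · show (1 : G)⁻¹ ∈ interior V
    rw [inv_one]
    exact mem_interior_iff_mem_nhds.2 hV
  · simpa [div_eq_mul_inv] using hVU a (interior_subset ha.1) b (interior_subset hb.1)
  · have ha' : a⁻¹ ∈ interior V := ha.2
    have hb' : b⁻¹ ∈ interior V := hb.2
    simpa [div_eq_mul_inv] using hVU a⁻¹ (interior_subset ha') b⁻¹ (interior_subset hb')

/-- Local separation for the LEFT action of a discrete subgroup. -/
alias exists_local_left := Literature.MeasureTheory.Group.DiscreteSubgroup.exists_local_left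

/-- Local separation for the RIGHT action (`Γ.op`) of a discrete subgroup. -/
theorem exists_local_op (Γ : Subgroup G) [DiscreteTopology Γ] (x : G) :
    ∃ V : Set G, IsOpen V ∧ x ∈ V ∧ ∀ γ : Γ.op, γ ≠ 1 → Disjoint (γ • V) V := by
  obtain ⟨U, hU, hU1⟩ := exists_nhds_one_eq_one Γ
  obtain ⟨W, hWo, hW1, -, hWl⟩ := exists_open_symm_nhds hU
  refine ⟨(fun w => x * w) '' W, isOpenMap_mul_left x W hWo, ⟨1, hW1, mul_one x⟩,
    fun γ hγ => Set.disjoint_left.2 ?_⟩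
  rintro z hz ⟨b, hb, rfl⟩
  obtain ⟨y, ⟨a, ha, rfl⟩, hy⟩ := mem_smul_set.1 hz
  have hmem : MulOpposite.unop (γ : Gᵐᵒᵖ) ∈ Γ := Subgroup.mem_op.1 γ.2
  apply hγ
  rw [Subgroup.smul_def, MulOpposite.smul_eq_mul_unop] at hy
  have hval : MulOpposite.unop (γ : Gᵐᵒᵖ) = a⁻¹ * b := by
    calc MulOpposite.unop (γ : Gᵐᵒᵖ)
        = (x * a)⁻¹ * ((x * a) * MulOpposite.unop (γ : Gᵐᵒᵖ)) := by group
    _ = a⁻¹ * b := by rw [hy]; group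
  have h1 : (⟨MulOpposite.unop (γ : Gᵐᵒᵖ), hmem⟩ : Γ) = 1 := by
    apply hU1
    show MulOpposite.unop (γ : Gᵐᵒᵖ) ∈ U
    rw [hval]
    exact hWl a ha b hb
  have h2 : MulOpposite.unop (γ : Gᵐᵒᵖ) = 1 := congrArg Subtype.val h1
  exact Subtype.ext ((MulOpposite.unop_eq_one_iff _).1 h2)

/-! ### Compact sets meeting every orbit of a cocompact subgroup -/

/-- If `G ⧸ Γ` is compact, some compact closed `K ⊆ G` meets every right `Γ`-orbit. -/
alias exists_isCompact_cover_op := Literature.MeasureTheory.Group.DiscreteSubgroup.exists_isCompact_cover_op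

/-- If `G ⧸ Γ` is compact and `Γ` is normal (e.g. `G` commutative), some compact closed `K ⊆ G`
meets every left `Γ`-orbit. -/
theorem exists_isCompact_cover_left [LocallyCompactSpace G] (Γ : Subgroup G) [Γ.Normal]
    [CompactSpace (G ⧸ Γ)] :
    ∃ K : Set G, IsCompact K ∧ IsClosed K ∧ ∀ x : G, ∃ γ : Γ, γ • x ∈ K := by
  obtain ⟨K, hKc, hKcl, hK⟩ := exists_isCompact_cover_op Γ
  refine ⟨K, hKc, hKcl, fun y => ?_⟩
  obtain ⟨γ, hγ⟩ := hK y
  have hg : MulOpposite.unop (γ : Gᵐᵒᵖ) ∈ Γ := Subgroup.mem_op.1 γ.2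
  refine ⟨⟨y * MulOpposite.unop (γ : Gᵐᵒᵖ) * y⁻¹,
    (inferInstance : Γ.Normal).conj_mem _ hg y⟩, ?_⟩
  rw [Subgroup.smul_def, MulOpposite.smul_eq_mul_unop] at hγ
  rw [Subgroup.mk_smul, smul_eq_mul]
  simpa [mul_assoc] using hγ

variable [SecondCountableTopology G] [MeasurableSpace G] [BorelSpace G]

/-- **Existence, left action, inside a covering measurable set `K`.** -/
theorem exists_fundamentalDomain_left_subset (Γ : Subgroup G) [DiscreteTopology Γ]
    {K : Set G} (hKm : MeasurableSet K) (hKcov : ∀ x : G, ∃ γ : Γ, γ • x ∈ K) :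
    ∃ 𝓕 : Set G, 𝓕 ⊆ K ∧ MeasurableSet 𝓕 ∧ ∀ x : G, ∃! γ : Γ, γ • x ∈ 𝓕 := by
  haveI := countable_of_discrete Γ
  exact exists_subset_measurableSet_existsUnique hKm hKcov fun x _ => exists_local_left Γ x

/-- **Existence, left action.**  A discrete subgroup of a second countable topological group has a
measurable fundamental domain in the exact sense `∀ x, ∃! γ : Γ, γ • x ∈ 𝓕`. -/
alias exists_fundamentalDomain_left := Literature.MeasureTheory.Group.DiscreteSubgroup.exists_fundamentalDomain_left

/-- **Existence, right action (`Γ.op`), inside a covering measurable set `K`.** -/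
alias exists_fundamentalDomain_op_subset := Literature.MeasureTheory.Group.DiscreteSubgroup.exists_fundamentalDomain_op_subset

/-- **Existence, right action (`Γ.op`).** -/
theorem exists_fundamentalDomain_op (Γ : Subgroup G) [DiscreteTopology Γ] :
    ∃ 𝓕 : Set G, MeasurableSet 𝓕 ∧ ∀ x : G, ∃! γ : Γ.op, γ • x ∈ 𝓕 := by
  obtain ⟨𝓕, -, h⟩ := exists_fundamentalDomain_op_subset Γ MeasurableSet.univ
    (fun x => ⟨1, mem_univ _⟩)
  exact ⟨𝓕, h⟩

/-- Measure form, left action: `IsFundamentalDomain Γ 𝓕 μ` for every measure `μ`. -/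
alias exists_isFundamentalDomain_left := Literature.MeasureTheory.Group.DiscreteSubgroup.exists_isFundamentalDomain_left

/-- Measure form, right action: `IsFundamentalDomain Γ.op 𝓕 μ` for every measure `μ`. -/
alias exists_isFundamentalDomain_op := Literature.MeasureTheory.Group.DiscreteSubgroup.exists_isFundamentalDomain_op

/-- (Ported verbatim from the HodgeCMPerL package; no docstring in the source.) -/
alias hasFundamentalDomain_left := Literature.MeasureTheory.Group.DiscreteSubgroup.hasFundamentalDomain_left

/-- (Ported verbatim from the HodgeCMPerL package; no docstring in the source.) -/
alias hasFundamentalDomain_op := Literature.MeasureTheory.Group.DiscreteSubgroup.hasFundamentalDomain_op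

/-! ## §4 Cocompact discrete subgroups: relatively compact fundamental domains -/

variable [LocallyCompactSpace G]

/-- **Cocompact case, right action.**  A relatively compact measurable fundamental domain. -/
alias exists_fundamentalDomain_op_relCompact := Literature.MeasureTheory.Group.DiscreteSubgroup.exists_fundamentalDomain_op_relCompact

/-- **Cocompact case, left action, `Γ` normal.** -/
alias exists_fundamentalDomain_left_relCompact := Literature.MeasureTheory.Group.DiscreteSubgroup.exists_fundamentalDomain_left_relCompact

/-- Measure form of the cocompact case, right action: a measurable fundamental domain of finite
measure for every measure finite on compact sets (every Haar measure). -/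
theorem exists_isFundamentalDomain_op_finite (Γ : Subgroup G) [DiscreteTopology Γ]
    [CompactSpace (G ⧸ Γ)] (μ : Measure G) [IsFiniteMeasureOnCompacts μ] :
    ∃ 𝓕 : Set G, MeasurableSet 𝓕 ∧ IsFundamentalDomain Γ.op 𝓕 μ ∧
      IsCompact (closure 𝓕) ∧ μ 𝓕 < ⊤ := by
  obtain ⟨𝓕, h𝓕m, hc, h⟩ := exists_fundamentalDomain_op_relCompact Γ
  exact ⟨𝓕, h𝓕m, isFundamentalDomain_of_existsUnique h𝓕m h μ, hc,
    (measure_mono subset_closure).trans_lt hc.measure_lt_top⟩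


-- port_pkg: scope closed for this part
end Group
end HodgeCM.PerL34.DiscreteFD
end
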